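import Summits.QuantumFields.YangMills.Theorems.BalabanUVNodesN15CovariantAveragingGauge
import Summits.QuantumFields.YangMills.Theorems.BalabanUVNodesN15CovariantAveragingTwoGrid
import Summits.QuantumFields.YangMills.Theorems.BalabanUVNodesN15CovariantAveragingHolonomy
import HarnessLib

/-!
# N15 = NE2 — PROGRAMME (PC-E), items (m1)+(m2) of dag-n15-c's `PCE-DESIGN-g31.md` §3: THE COVARIANT TWO-GRID PULL-BACK `τ_{U′}` (King's piecewise-constant
# prolongation of coloured fields from spacing `L^{-k}` to `L^{-m}L^{-k}`, every value PARALLEL-TRANSPORTED from the base point `σπx′` of the King block to `x′`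
# along the block's staircase in the FINE field `U′`) AND ITS GAUGE LAW `τ_{U′^{u′}} = Ad(u′)·τ_{U′}·Ad(u′∘σ)⁻¹` (dag-n15-a g37, by dag-n15-c g31's offer)

Cell `pub-ymgap`, seat `pub-ymgap-dag-n15-a` (generation g37; KNIT-BY-NAME, count-neutral; HUMAN RULING D-0062; chair R424 venue).  `bears_on: R4∕N15 · K3⁸
SpineGivenEndpointR13SepCoPHV (stmt-QuantumFields-27366)`; filed `--supports stmt-QuantumFields-27366 --as helper` — COUNT-NEUTRAL.  Plumbing `def`s (the King-block
staircase on a fine torus `Tor (fine N M)` with block side `R`, the section `σ`, the two pull-backs) + their algebra (`rfl`∕telescoping); 0 `sorry`, NO estimate, nothing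
printed asserted.  Imports BY NAME n15-c∕198 `…CovariantAveragingGauge` (through it n15-c∕197′ `…CovariantLandauCovariance`: `gaugeTb`, `mprod_telescope`; dag-n15-b∕n15-c
`…CurvedGaugeCovariance`: `mmulOp_conj`, `mmulOp_one`), n15-c∕183 `…CovariantAveragingTwoGrid` (dag-n15-a `kingPr`∕`kingPrV`∕`kingPr_val`, pub-balaban `pull`, `liftMap`),
n15-c∕182 `…CovariantAveragingHolonomy` (`coordMat_Ad_mprod`).  Nothing in the tree is modified, no landed name re-declared.

WHY (dag-n15-c g31, HOME `pub-ymgap-dag-n15-c/PCE-DESIGN-g31.md` §2–§3, offer I.20773).  (PC-E) — the per-cube two-grid η-defect of Bałaban's operator∕propagator over the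
per-cube class (3.35) — is reduced by n15-c∕328 `idef_inverse_of_reg335Cube_twoGrid` to the operator defect `A′τ₂ − τ₁A` for ARBITRARY linear two-grid transports `τ`.  §2 of the
memo shows that the FLAT pull-back `(τf)(x′) = f(πx′)` (King p.664; the lane's `pull (liftMap kingPrV ι)`) gives an `O(1)` defect over the per-cube class (pure-gauge
witness) and proposes the COVARIANT pull-back `(τ_{U′}f)(x′) = Ad(U′(Γ: x′ ← σπx′))·f(πx′)` — transport along the fixed staircase of the King block from its base point
`σπx′` — whose defect is GAUGE-COVARIANT: `τ_{U′^{u′}} = Ad(u′)·τ_{U′}·Ad(u′∘σ)⁻¹`.  THIS FILE types (m1) that object and proves (m2) that law, at the lane's real-coordinate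
level (transporter data `T′ : Fin (d+1) → Tor (fine N M) × Fin (d+1) → Matrix ι ι ℝ`, `= cvT e U′`; gauge action `gaugeTb M N W T′` with `W = coordMat e Ad_{u′}`
fibrewise orthogonal — n15-c∕201 `cvT_gauge` is the dictionary to `U(N)`), generic in `(M, N, R)` resp. King's pair `(M, L, k, m)` so that both the global-gauge lane
(n15-c∕235–258) and the per-cube lane (n15-c∕260–328) read it.  (m3) (covariance of the operator defect) and (m4)–(m5) are n15-c's.

OBJECTS AND RESULTS ([folklore] plumbing unless tagged; equation tags mark the printed formula an object transcribes — nothing printed is asserted).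
* §1 (any fine torus `Tor (fine N M)`, block side `R`): `kingLineT T μ ν x s` (the straight transport: `s` steps from `x` in direction `μ`, read on the slice `ν`; any monoid),
  `kingOff R x μ = val(x_μ) mod R`, `kingBase R x` (`val = R⌊val(x_μ)∕R⌋`: the base point of `x`'s `R`-block), `kingLegStart R x i` (the start of leg `i` of the block
  staircase: coordinates `< i` already at `x`, the others at the base), ★ `kingStairT R T p` (the transport along the `R`-block staircase from `kingBase p.1` to `p.1` on
  the slice `p.2`, legs in coordinate order); `kingLineT_one`∕`kingStairT_one`, `kingLegStart_zero`∕`_succ`∕`_of_le` (the legs abut, start at the base, end at `x`),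
  `kingBase_val`, `kingOff_lt`, ★ `kingLineT_gauge`, ★★ `kingStairT_gauge` (`kingStairT R (T^W) p = W(kingBase p.1)·kingStairT R T p·W(p.1)ᵀ` for `WᵀW = 1` —
  telescoping, n15-c∕197′'s `mprod_telescope`), ★ `kingStairT_conj` (for `T = Ad ∘ U` the transport IS `coordMat e Ad_{hol}`, the holonomy being `kingStairT R U p` itself).
* §2 (King's pair `N = L^m·L^k`, `R = L^m`): `kingSec L k m M` (the section `σ`: coarse site ↦ base point of its King block), `kingPr_kingSec` (`πσ = id`),
  `kingBase_eq_kingSec_kingPr` (`base = σ∘π`), `kingPr_kingLegStart` (the staircase stays over `πx′`), `mmulOp_comp_pullMap` (`M_{C∘π}∘P̂ = P̂∘M_C`);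
  ★★ `ctauV L k m M T′ := M_{(kingStairT T′)ᵀ} ∘ P̂` — THE COVARIANT TWO-GRID PULL-BACK OF COLOURED 1-FORMS (bond-point fields; King's piecewise-constant pull-back
  `P̂ = pull (liftMap kingPrV ι)` reads the coarse bond `(πx′, ν)` at every fine bond `(x′, ν)`, then the value is transported from `σπx′` to `x′` on the slice `ν` — no
  transport along the bond's own direction), ★ `ctauS` (the same for coloured SITE fields, site transporters read on slice `0`), `ctauV_apply`∕`ctauS_apply`,
  `ctauV_one`∕`ctauS_one` (at `T′ ≡ 1` they ARE the flat pull-backs), ★★★ `ctauV_gauge`∕`ctauS_gauge` (THE GAUGE LAW (m2): `ctau (T′^W) = M_W ∘ ctau T′ ∘ M_{(W∘σ)ᵀ}`),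
  ★ `ctauV_pureGauge`∕`ctauS_pureGauge` (`τ_{δu′} = Ad(u′)·P̂·Ad(u′∘σ)ᵀ`).

HONEST FRAMING ∕ LIMITS.  Definitions and exact algebra only; the objects are the SHAPE of the parallel transports in [Balaban1985Averaging] (125) p.36 ∕ King's pairing
[King1986] p.664 combined as dag-n15-c's memo prescribes — a MODEL-level design object of this programme, NOT a printed operator of [B9]; no estimate (the `O(η|A′|)`
letters of `τ_{U′} − P̂` in the cube gauges are (m4), not here); MODEL carriers; NE2⁺ NOT PRINTED, NOT proved; N15 of record untouched (DISCHARGED AS CONSUMED, p687738);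
K3⁸ OPEN; counts of record UNMOVED (typed 28∕28 · discharged 8∕27); one finite 𝕋⁴ at fixed ε per index — NOT infinite volume, NOT OS on ℝ⁴, NOT a mass gap, NOT Clay.
Restate-immune (no Theses import).
-/

noncomputable section

open scoped BigOperators Matrix Matrix.Norms.L2Operator

namespace Summit.QuantumFields.YangMills.BalabanUVNodes.N15.CovAvg

open Literature.MathematicalPhysics.QuantumFieldTheory.Balaban1983to89
open Literature.MathematicalPhysics.QuantumFieldTheory.Balaban1983to89.B5Prop11Plancherel (Tor fine unitVec)
open Literature.MathematicalPhysics.QuantumFieldTheory.Balaban1983to89.T4EtaRateCoeffDefect (pull pull_apply)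
open Summit.QuantumFields.YangMills.BalabanUVNodes.N15.VectorPiece (kingPr kingPrV kingPrV_eq kingPr_val)
open Summit.QuantumFields.YangMills.BalabanUVNodes.N15.MatrixSpecies (mmulOp mmulOp_apply coordMat liftMap)
open Summit.QuantumFields.YangMills.BalabanUVNodes.N15.CurvedSpecies (mmulOp_conj mmulOp_one coordMat_mulLeftRight_mul)
open Summit.QuantumFields.YangMills.BalabanUVNodes.N15.CovLandau (gaugeTb gaugeT gaugeTb_lift mprod_telescope)

variable {d : ℕ}

/-! ## §1 The King-block staircase transport on a fine torus -/

section KingStair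

variable (M : Fin (d + 1) → ℕ) [∀ μ, NeZero (M μ)] (N : ℕ) [NeZero N] (R : ℕ)

/-- THE STRAIGHT TRANSPORT: the ordered product of `s` transporters from the site `x` in direction `μ`, read on the slice `ν` of the bond-point carrier (any monoid of
coefficients: `U(N)` holonomies or their `Ad`-coordinates). [cite: Balaban1984PropagatorsI, (1.18) p.20 («U([x, x(b)])»: shape)] -/
def kingLineT {A : Type} [Monoid A] (T : Fin (d + 1) → Tor (fine N M) × Fin (d + 1) → A) (μ ν : Fin (d + 1)) (x : Tor (fine N M)) (s : ℕ) : A :=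
  mprod (fun t => T μ (x + t • unitVec (fine N M) μ, ν)) s

/-- THE OFFSET of a fine site inside its `R`-block: `val(x_μ) mod R`. [cite: King1986, p.664 (pairing convention)] -/
def kingOff (x : Tor (fine N M)) (μ : Fin (d + 1)) : ℕ := (x μ).val % R

/-- THE BASE POINT of the `R`-block of a fine site: coordinates `R·⌊val(x_μ)∕R⌋`. [cite: King1986, p.664 (pairing convention)] -/
def kingBase (x : Tor (fine N M)) : Tor (fine N M) := fun μ => ((R * ((x μ).val / R) : ℕ) : ZMod (fine N M μ))

/-- THE START OF LEG `i` of the block staircase to `x`: the coordinates `< i` are already those of `x`, the others still those of the base point. [folklore] -/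
def kingLegStart (x : Tor (fine N M)) (i : ℕ) : Tor (fine N M) := fun ν => if (ν : ℕ) < i then x ν else kingBase M N R x ν

/-- ★ THE KING-BLOCK STAIRCASE TRANSPORT from the base point of `p.1`'s `R`-block to `p.1`, legs in coordinate order, on the slice `p.2` (the parallel transport of
Bałaban's averaging (125) inside ONE block of side `R`). [cite: Balaban1985Averaging, (125) p.36 («R(V₀(Γ_{c₋,x}))»: shape); King1986, p.664] -/
def kingStairT {A : Type} [Monoid A] (T : Fin (d + 1) → Tor (fine N M) × Fin (d + 1) → A) (p : Tor (fine N M) × Fin (d + 1)) : A :=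
  mprod (fun i => if h : i < d + 1 then kingLineT M N T ⟨i, h⟩ p.2 (kingLegStart M N R p.1 i) (kingOff M N R p.1 ⟨i, h⟩) else 1) (d + 1)

omit [∀ μ, NeZero (M μ)] [NeZero N] in
/-- At `T ≡ 1` the straight transport is `1`. [folklore] -/
theorem kingLineT_one {A : Type} [Monoid A] (μ ν : Fin (d + 1)) (x : Tor (fine N M)) (s : ℕ) :
    kingLineT M N (fun _ _ => (1 : A)) μ ν x s = 1 :=
  mprod_one _

omit [∀ μ, NeZero (M μ)] [NeZero N] in
/-- At `T ≡ 1` the staircase transport is `1`. [folklore] -/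
theorem kingStairT_one {A : Type} [Monoid A] (p : Tor (fine N M) × Fin (d + 1)) : kingStairT M N R (fun _ _ => (1 : A)) p = 1 :=
  mprod_eq_one fun i _ => by
    by_cases h : i < d + 1
    · rw [dif_pos h, kingLineT_one]
    · rw [dif_neg h]

omit [∀ μ, NeZero (M μ)] [NeZero N] in
/-- The offset is below the block side. [folklore] -/
theorem kingOff_lt (hR : 0 < R) (x : Tor (fine N M)) (μ : Fin (d + 1)) : kingOff M N R x μ < R :=
  Nat.mod_lt _ hR

/-- The base point's coordinates: `val = R·⌊val(x_μ)∕R⌋`. [folklore] -/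
theorem kingBase_val (x : Tor (fine N M)) (μ : Fin (d + 1)) : (kingBase M N R x μ).val = R * ((x μ).val / R) := by
  simp only [kingBase]
  rw [ZMod.val_natCast, Nat.mod_eq_of_lt (lt_of_le_of_lt (Nat.mul_div_le _ _) (ZMod.val_lt _))]

/-- Base plus offset is the site: `base_μ + (val(x_μ) mod R) = x_μ`. [folklore] -/
theorem kingBase_add_kingOff (x : Tor (fine N M)) (μ : Fin (d + 1)) :
    kingBase M N R x μ + ((kingOff M N R x μ : ℕ) : ZMod (fine N M μ)) = x μ := by
  simp only [kingBase, kingOff]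
  rw [← Nat.cast_add, Nat.div_add_mod, ZMod.natCast_zmod_val]

omit [∀ μ, NeZero (M μ)] [NeZero N] in
/-- The staircase starts at the base point. [folklore] -/
theorem kingLegStart_zero (x : Tor (fine N M)) : kingLegStart M N R x 0 = kingBase M N R x := by
  funext ν
  simp [kingLegStart]

omit [∀ μ, NeZero (M μ)] [NeZero N] in
/-- After the last leg the staircase is at `x`. [folklore] -/
theorem kingLegStart_of_le (x : Tor (fine N M)) {i : ℕ} (hi : d + 1 ≤ i) : kingLegStart M N R x i = x := by
  funext ν
  simp [kingLegStart, lt_of_lt_of_le ν.isLt hi]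

/-- LEGS ABUT: the start of leg `i + 1` is the start of leg `i` moved by the offset `val(x_i) mod R` in direction `i`. [folklore] -/
theorem kingLegStart_succ (x : Tor (fine N M)) (i : ℕ) (hi : i < d + 1) :
    kingLegStart M N R x (i + 1) = kingLegStart M N R x i + kingOff M N R x ⟨i, hi⟩ • unitVec (fine N M) ⟨i, hi⟩ := by
  funext ν
  simp only [kingLegStart, Pi.add_apply, Pi.smul_apply, unitVec]
  by_cases hν : ν = ⟨i, hi⟩
  · subst hν
    have h1 : ((⟨i, hi⟩ : Fin (d + 1)) : ℕ) < i + 1 := Nat.lt_succ_self i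
    have h2 : ¬ ((⟨i, hi⟩ : Fin (d + 1)) : ℕ) < i := lt_irrefl i
    rw [if_pos h1, if_neg h2, Pi.single_eq_same, nsmul_eq_mul, mul_one, kingBase_add_kingOff]
  · have hne : (ν : ℕ) ≠ i := fun h => hν (Fin.ext h)
    rw [Pi.single_eq_of_ne hν, smul_zero, add_zero]
    by_cases h : (ν : ℕ) < i
    · rw [if_pos (show (ν : ℕ) < i + 1 by omega), if_pos h]
    · rw [if_neg (show ¬((ν : ℕ) < i + 1) by omega), if_neg h]

variable {ι : Type} [Fintype ι] [DecidableEq ι]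

omit [∀ μ, NeZero (M μ)] [NeZero N] in
/-- ★ THE STRAIGHT TRANSPORT IS CONJUGATED under a gauge transformation: `kingLineT (T^W) μ ν x s = W(x)·kingLineT T μ ν x s·W(x + s·e_μ)ᵀ` (`WᵀW = 1`).
[cite: Balaban1985BackgroundPropagators, (3.32) p.395 (mechanism)] -/
theorem kingLineT_gauge {W : Tor (fine N M) → Matrix ι ι ℝ} (hW : ∀ x, (W x)ᵀ * W x = 1) (T : Fin (d + 1) → Tor (fine N M) × Fin (d + 1) → Matrix ι ι ℝ)
    (μ ν : Fin (d + 1)) (x : Tor (fine N M)) (s : ℕ) :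
    kingLineT M N (gaugeTb M N W T) μ ν x s = W x * kingLineT M N T μ ν x s * (W (x + s • unitVec (fine N M) μ))ᵀ := by
  have hfac : ∀ t < s, gaugeTb M N W T μ (x + t • unitVec (fine N M) μ, ν) =
      W ((fun t : ℕ => x + t • unitVec (fine N M) μ) t) * T μ (x + t • unitVec (fine N M) μ, ν) * (W ((fun t : ℕ => x + t • unitVec (fine N M) μ) (t + 1)))ᵀ := by
    intro t _
    simp only [gaugeTb, add_smul, one_smul, add_assoc]
  rw [kingLineT, kingLineT, mprod_congr hfac, mprod_telescope _ hW]
  simp only [zero_smul, add_zero]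

/-- ★★ **THE KING-BLOCK STAIRCASE TRANSPORT IS CONJUGATED**: `kingStairT R (T^W) p = W(base)·kingStairT R T p·W(p.1)ᵀ` for fibrewise orthogonal `W` — the telescoping
of the gauge factors along the staircase from the block's base point to `p.1`. [cite: Balaban1985BackgroundPropagators, (3.32) p.395 («R(U^u(Γ_{y,x})) = R(u(y))R(U(Γ_{y,x}))R(u⁻¹(x))»: mechanism)] -/
theorem kingStairT_gauge {W : Tor (fine N M) → Matrix ι ι ℝ} (hW : ∀ x, (W x)ᵀ * W x = 1) (T : Fin (d + 1) → Tor (fine N M) × Fin (d + 1) → Matrix ι ι ℝ)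
    (p : Tor (fine N M) × Fin (d + 1)) :
    kingStairT M N R (gaugeTb M N W T) p = W (kingBase M N R p.1) * kingStairT M N R T p * (W p.1)ᵀ := by
  have hfac : ∀ i < d + 1, (if h : i < d + 1 then kingLineT M N (gaugeTb M N W T) ⟨i, h⟩ p.2 (kingLegStart M N R p.1 i) (kingOff M N R p.1 ⟨i, h⟩) else 1) =
      W ((fun i : ℕ => kingLegStart M N R p.1 i) i) *
        (if h : i < d + 1 then kingLineT M N T ⟨i, h⟩ p.2 (kingLegStart M N R p.1 i) (kingOff M N R p.1 ⟨i, h⟩) else 1) *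
          (W ((fun i : ℕ => kingLegStart M N R p.1 i) (i + 1)))ᵀ := by
    intro i hi
    rw [dif_pos hi, dif_pos hi, kingLineT_gauge M N hW, ← kingLegStart_succ M N R p.1 i hi]
  rw [kingStairT, kingStairT, mprod_congr hfac, mprod_telescope _ hW]
  simp only [kingLegStart_zero, kingLegStart_of_le M N R p.1 le_rfl]

omit [∀ μ, NeZero (M μ)] [NeZero N] in
/-- ★ FOR `Ad`-COORDINATES OF A `U(N)` FIELD THE STAIRCASE TRANSPORT IS THE ADJOINT ACTION OF THE STAIRCASE HOLONOMY: `kingStairT R (Ad ∘ U) p = coordMat e Ad_{kingStairT R U p}`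
(the datum `fun μ q => coordMat e Ad_{U_μ(q)}` is n15-c∕128's `cvT e U`, `rfl`). [cite: Balaban1985Averaging, (125) p.36 («R(V₀(Γ_{c₋,x}))»)] -/
theorem kingStairT_conj {mm : Type} [Fintype mm] [DecidableEq mm] (e : Matrix mm mm ℂ ≃L[ℝ] (ι → ℝ)) (U : Fin (d + 1) → Tor (fine N M) × Fin (d + 1) → Matrix mm mm ℂ)
    (p : Tor (fine N M) × Fin (d + 1)) :
    kingStairT M N R (fun μ q => coordMat e (ContinuousLinearMap.mulLeftRight ℝ (Matrix mm mm ℂ) (U μ q) (U μ q)ᴴ)) p =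
      coordMat e (ContinuousLinearMap.mulLeftRight ℝ (Matrix mm mm ℂ) (kingStairT M N R U p) (kingStairT M N R U p)ᴴ) := by
  rw [kingStairT, kingStairT, ← coordMat_Ad_mprod]
  refine mprod_congr fun i hi => ?_
  rw [dif_pos hi, dif_pos hi]
  exact coordMat_Ad_mprod e _ _

end KingStair

/-! ## §2 King's pair `N = L^m·L^k`, `R = L^m`: the section and the covariant two-grid pull-backs -/

section KingPair

variable (M : Fin (d + 1) → ℕ) [∀ μ, NeZero (M μ)] (L k m : ℕ) [NeZero L] {ι : Type} [Fintype ι] [DecidableEq ι]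

/-- THE SECTION `σ` OF KING's PAIRING: a coarse site `x` (spacing `L^{-k}`) ↦ the base point of its King block on the fine torus (coordinates `L^m·val(x_μ)`).
[cite: King1986, p.664 (pairing convention)] -/
def kingSec (x : Tor (fine (L ^ k) M)) : Tor (fine (L ^ m * L ^ k) M) := fun μ => ((L ^ m * (x μ).val : ℕ) : ZMod (fine (L ^ m * L ^ k) M μ))

/-- `val(σ(x)_μ) = L^m·val(x_μ)`. [folklore] -/
theorem kingSec_val (x : Tor (fine (L ^ k) M)) (μ : Fin (d + 1)) : (kingSec M L k m x μ).val = L ^ m * (x μ).val := by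
  simp only [kingSec]
  rw [ZMod.val_natCast, Nat.mod_eq_of_lt]
  have h : (x μ).val < L ^ k * M μ := ZMod.val_lt (x μ)
  calc L ^ m * (x μ).val < L ^ m * (L ^ k * M μ) := Nat.mul_lt_mul_of_pos_left h (Nat.pos_of_ne_zero (NeZero.ne _))
    _ = L ^ m * L ^ k * M μ := (Nat.mul_assoc _ _ _).symm

/-- `π ∘ σ = id`. [cite: King1986, p.664 (pairing convention)] -/
theorem kingPr_kingSec (x : Tor (fine (L ^ k) M)) : kingPr L k m M (kingSec M L k m x) = x := by
  funext μ
  apply ZMod.val_injective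
  rw [kingPr_val, kingSec_val, Nat.mul_div_cancel_left _ (Nat.pos_of_ne_zero (NeZero.ne _))]

/-- THE BASE POINT IS `σ ∘ π`: `kingBase (L^m) x′ = σ(πx′)`. [cite: King1986, p.664 (pairing convention)] -/
theorem kingBase_eq_kingSec_kingPr (x' : Tor (fine (L ^ m * L ^ k) M)) : kingBase M (L ^ m * L ^ k) (L ^ m) x' = kingSec M L k m (kingPr L k m M x') := by
  funext μ
  simp only [kingBase, kingSec]
  rw [kingPr_val]

/-- THE STAIRCASE STAYS OVER `πx′`: every leg start projects to `πx′`. [folklore] -/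
theorem kingPr_kingLegStart (x' : Tor (fine (L ^ m * L ^ k) M)) (i : ℕ) : kingPr L k m M (kingLegStart M (L ^ m * L ^ k) (L ^ m) x' i) = kingPr L k m M x' := by
  have hLm : 0 < L ^ m := Nat.pos_of_ne_zero (NeZero.ne _)
  funext μ
  apply ZMod.val_injective
  rw [kingPr_val, kingPr_val]
  simp only [kingLegStart]
  by_cases h : (μ : ℕ) < i
  · rw [if_pos h]
  · rw [if_neg h, kingBase_val, Nat.mul_div_cancel_left _ hLm]

omit [DecidableEq ι] in
/-- `M_{C∘π} ∘ P̂ = P̂ ∘ M_C` for the piecewise-constant pull-back `P̂` along ANY map `π` (the tree's `BackgroundMatrixByParts.mmulOp_comp_pull` is the `Equiv` case). [folklore] -/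
theorem mmulOp_comp_pullMap {X X' : Type} (π : X' → X) (C : X → Matrix ι ι ℝ) :
    mmulOp (fun x' => C (π x')) ∘ₗ pull (liftMap π ι) = pull (liftMap π ι) ∘ₗ mmulOp C := by
  refine LinearMap.ext fun f => funext fun p => ?_
  simp only [LinearMap.comp_apply, mmulOp_apply, pull_apply, liftMap]

/-- ★★ **THE COVARIANT TWO-GRID PULL-BACK `τ_{U′}` OF COLOURED 1-FORMS** (bond-point fields): King's piecewise-constant pull-back `P̂` (every fine bond `(x′, ν)` reads the coarse bond
`(πx′, ν)`) followed by the transport of the value from the block's base point `σπx′` to `x′` along the King-block staircase of the FINE transporter datum `T′` on the slice `ν`: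
`(τ_{T′} f)((x′, ν), j) = Σ_i (kingStairT T′ (x′, ν))_{ij} f((πx′, ν), i)` (the transpose acts, as in the weighted adjoint `Q*`). dag-n15-c's design object for (PC-E).
[cite: Balaban1985Averaging, (125) p.36 (transports: shape); King1986, p.664 (pairing)] -/
def ctauV (T' : Fin (d + 1) → Tor (fine (L ^ m * L ^ k) M) × Fin (d + 1) → Matrix ι ι ℝ) :
    ((Tor (fine (L ^ k) M) × Fin (d + 1)) × ι → ℝ) →ₗ[ℝ] ((Tor (fine (L ^ m * L ^ k) M) × Fin (d + 1)) × ι → ℝ) :=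
  mmulOp (fun p' => (kingStairT M (L ^ m * L ^ k) (L ^ m) T' p')ᵀ) ∘ₗ pull (liftMap (kingPrV L k m M) ι)

/-- ★ **THE COVARIANT TWO-GRID PULL-BACK OF COLOURED SITE FIELDS** (site transporter datum `T′_μ(x′)`, staircase read on the slice `0`):
`(τ_{T′} f)(x′, j) = Σ_i (kingStairT (T′ lifted) (x′, 0))_{ij} f(πx′, i)`. [cite: Balaban1985Averaging, (125) p.36 (shape); King1986, p.664] -/
def ctauS (T' : Fin (d + 1) → Tor (fine (L ^ m * L ^ k) M) → Matrix ι ι ℝ) :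
    (Tor (fine (L ^ k) M) × ι → ℝ) →ₗ[ℝ] (Tor (fine (L ^ m * L ^ k) M) × ι → ℝ) :=
  mmulOp (fun x' => (kingStairT M (L ^ m * L ^ k) (L ^ m) (fun μ b => T' μ b.1) (x', 0))ᵀ) ∘ₗ pull (liftMap (kingPr L k m M) ι)

omit [∀ μ, NeZero (M μ)] [NeZero L] in
/-- Pointwise form of `τ_{T′}` on 1-forms. [folklore] -/
theorem ctauV_apply (T' : Fin (d + 1) → Tor (fine (L ^ m * L ^ k) M) × Fin (d + 1) → Matrix ι ι ℝ) (f : (Tor (fine (L ^ k) M) × Fin (d + 1)) × ι → ℝ)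
    (q : (Tor (fine (L ^ m * L ^ k) M) × Fin (d + 1)) × ι) :
    ctauV M L k m T' f q = ∑ i, kingStairT M (L ^ m * L ^ k) (L ^ m) T' q.1 i q.2 * f ((kingPr L k m M q.1.1, q.1.2), i) := by
  simp only [ctauV, LinearMap.comp_apply, mmulOp_apply, pull_apply, liftMap, Matrix.transpose_apply, kingPrV_eq]

omit [∀ μ, NeZero (M μ)] [NeZero L] in
/-- Pointwise form of `τ_{T′}` on site fields. [folklore] -/
theorem ctauS_apply (T' : Fin (d + 1) → Tor (fine (L ^ m * L ^ k) M) → Matrix ι ι ℝ) (f : Tor (fine (L ^ k) M) × ι → ℝ) (q : Tor (fine (L ^ m * L ^ k) M) × ι) :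
    ctauS M L k m T' f q = ∑ i, kingStairT M (L ^ m * L ^ k) (L ^ m) (fun μ b => T' μ b.1) (q.1, 0) i q.2 * f (kingPr L k m M q.1, i) := by
  simp only [ctauS, LinearMap.comp_apply, mmulOp_apply, pull_apply, liftMap, Matrix.transpose_apply]

omit [∀ μ, NeZero (M μ)] [NeZero L] in
/-- AT `T′ ≡ 1` THE COVARIANT PULL-BACK IS THE FLAT ONE: `τ_1 = P̂ = pull (liftMap kingPrV ι)` (King's piecewise-constant prolongation of 1-forms). [cite: King1986, p.664] -/
theorem ctauV_one : ctauV M L k m (fun _ _ => (1 : Matrix ι ι ℝ)) = pull (liftMap (kingPrV L k m M) ι) := by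
  rw [ctauV, show (fun p' : Tor (fine (L ^ m * L ^ k) M) × Fin (d + 1) => (kingStairT M (L ^ m * L ^ k) (L ^ m) (fun _ _ => (1 : Matrix ι ι ℝ)) p')ᵀ) = fun _ => 1 from
    funext fun p' => by rw [kingStairT_one, Matrix.transpose_one], mmulOp_one, LinearMap.id_comp]

omit [∀ μ, NeZero (M μ)] [NeZero L] in
/-- … and on site fields: `τ_1 = pull (liftMap kingPr ι)`. [cite: King1986, p.664] -/
theorem ctauS_one : ctauS M L k m (fun _ _ => (1 : Matrix ι ι ℝ)) = pull (liftMap (kingPr L k m M) ι) := by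
  rw [ctauS, show (fun x' : Tor (fine (L ^ m * L ^ k) M) => (kingStairT M (L ^ m * L ^ k) (L ^ m) (fun _ _ => (1 : Matrix ι ι ℝ)) (x', 0))ᵀ) = fun _ => 1 from
    funext fun x' => by rw [kingStairT_one, Matrix.transpose_one], mmulOp_one, LinearMap.id_comp]

/-- ★★★ **THE GAUGE LAW OF THE COVARIANT PULL-BACK (dag-n15-c's (m2))**: `τ_{T′^W} = M_W ∘ τ_{T′} ∘ M_{(W∘σ)ᵀ}` for fibrewise orthogonal `W` — in `U(N)` terms
`τ_{U′^{u′}} = Ad(u′)·τ_{U′}·Ad(u′∘σ)⁻¹` (`W = coordMat e Ad_{u′}`, `T′ = cvT e U′`, `T′^W = cvT e (U′^{u′})` by n15-c∕201 `cvT_gauge`): the two-grid defects built with `τ_{U′}`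
are gauge-COVARIANT. [cite: Balaban1985BackgroundPropagators, (3.31)–(3.32) p.395 (transformation laws: mechanism)] -/
theorem ctauV_gauge {W : Tor (fine (L ^ m * L ^ k) M) → Matrix ι ι ℝ} (hW : ∀ x, (W x)ᵀ * W x = 1)
    (T' : Fin (d + 1) → Tor (fine (L ^ m * L ^ k) M) × Fin (d + 1) → Matrix ι ι ℝ) :
    ctauV M L k m (gaugeTb M (L ^ m * L ^ k) W T') =
      mmulOp (fun p' : Tor (fine (L ^ m * L ^ k) M) × Fin (d + 1) => W p'.1) ∘ₗ ctauV M L k m T' ∘ₗ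
        mmulOp (fun p : Tor (fine (L ^ k) M) × Fin (d + 1) => (W (kingSec M L k m p.1))ᵀ) := by
  have h1 : (fun p' : Tor (fine (L ^ m * L ^ k) M) × Fin (d + 1) => (kingStairT M (L ^ m * L ^ k) (L ^ m) (gaugeTb M (L ^ m * L ^ k) W T') p')ᵀ) =
      fun p' => (fun q : Tor (fine (L ^ m * L ^ k) M) × Fin (d + 1) => W q.1) p' * (fun q : Tor (fine (L ^ m * L ^ k) M) × Fin (d + 1) => (kingStairT M (L ^ m * L ^ k) (L ^ m) T' q)ᵀ) p' *
        (fun q : Tor (fine (L ^ m * L ^ k) M) × Fin (d + 1) => (fun p : Tor (fine (L ^ k) M) × Fin (d + 1) => (W (kingSec M L k m p.1))ᵀ) (kingPrV L k m M q)) p' := by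
    funext p'
    simp only [kingPrV_eq]
    rw [kingStairT_gauge M _ _ hW, kingBase_eq_kingSec_kingPr, Matrix.transpose_mul, Matrix.transpose_mul, Matrix.transpose_transpose]
    simp only [Matrix.mul_assoc]
  rw [ctauV, ctauV, h1, mmulOp_conj]
  simp only [LinearMap.comp_assoc]
  rw [mmulOp_comp_pullMap (kingPrV L k m M) (fun p : Tor (fine (L ^ k) M) × Fin (d + 1) => (W (kingSec M L k m p.1))ᵀ)]

/-- ★★ **THE GAUGE LAW ON SITE FIELDS**: `τ_{T′^W} = M_W ∘ τ_{T′} ∘ M_{(W∘σ)ᵀ}` (site transporters, action `gaugeT`). [cite: Balaban1985BackgroundPropagators, (3.31)–(3.32) p.395 (mechanism)] -/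
theorem ctauS_gauge {W : Tor (fine (L ^ m * L ^ k) M) → Matrix ι ι ℝ} (hW : ∀ x, (W x)ᵀ * W x = 1) (T' : Fin (d + 1) → Tor (fine (L ^ m * L ^ k) M) → Matrix ι ι ℝ) :
    ctauS M L k m (gaugeT M (L ^ m * L ^ k) W T') =
      mmulOp W ∘ₗ ctauS M L k m T' ∘ₗ mmulOp (fun x : Tor (fine (L ^ k) M) => (W (kingSec M L k m x))ᵀ) := by
  have h1 : (fun x' : Tor (fine (L ^ m * L ^ k) M) => (kingStairT M (L ^ m * L ^ k) (L ^ m) (fun μ b => gaugeT M (L ^ m * L ^ k) W T' μ b.1) (x', 0))ᵀ) =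
      fun x' => W x' * (fun y : Tor (fine (L ^ m * L ^ k) M) => (kingStairT M (L ^ m * L ^ k) (L ^ m) (fun μ b => T' μ b.1) (y, 0))ᵀ) x' *
        (fun y : Tor (fine (L ^ m * L ^ k) M) => (fun x : Tor (fine (L ^ k) M) => (W (kingSec M L k m x))ᵀ) (kingPr L k m M y)) x' := by
    funext x'
    simp only []
    rw [← gaugeTb_lift, kingStairT_gauge M _ _ hW, kingBase_eq_kingSec_kingPr, Matrix.transpose_mul, Matrix.transpose_mul, Matrix.transpose_transpose]
    simp only [Matrix.mul_assoc]
  rw [ctauS, ctauS, h1, mmulOp_conj]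
  simp only [LinearMap.comp_assoc]
  rw [mmulOp_comp_pullMap (kingPr L k m M) (fun x : Tor (fine (L ^ k) M) => (W (kingSec M L k m x))ᵀ)]

/-- ★ THE PURE-GAUGE COROLLARY (the memo's witness case): for `T′ = 1^W` (a pure gauge `δu′` in coordinates) `τ_{δu′} = M_W ∘ P̂ ∘ M_{(W∘σ)ᵀ}` — the covariant pull-back of a pure
gauge IS the flat pull-back twisted by the gauge at both ends. [cite: Balaban1985BackgroundPropagators, (3.31)–(3.32) p.395 (mechanism)] -/
theorem ctauV_pureGauge {W : Tor (fine (L ^ m * L ^ k) M) → Matrix ι ι ℝ} (hW : ∀ x, (W x)ᵀ * W x = 1) :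
    ctauV M L k m (gaugeTb M (L ^ m * L ^ k) W (fun _ _ => 1)) =
      mmulOp (fun p' : Tor (fine (L ^ m * L ^ k) M) × Fin (d + 1) => W p'.1) ∘ₗ pull (liftMap (kingPrV L k m M) ι) ∘ₗ
        mmulOp (fun p : Tor (fine (L ^ k) M) × Fin (d + 1) => (W (kingSec M L k m p.1))ᵀ) := by
  rw [ctauV_gauge M L k m hW, ctauV_one]

/-- ★ … and on site fields. [cite: Balaban1985BackgroundPropagators, (3.31)–(3.32) p.395 (mechanism)] -/
theorem ctauS_pureGauge {W : Tor (fine (L ^ m * L ^ k) M) → Matrix ι ι ℝ} (hW : ∀ x, (W x)ᵀ * W x = 1) :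
    ctauS M L k m (gaugeT M (L ^ m * L ^ k) W (fun _ _ => 1)) =
      mmulOp W ∘ₗ pull (liftMap (kingPr L k m M) ι) ∘ₗ mmulOp (fun x : Tor (fine (L ^ k) M) => (W (kingSec M L k m x))ᵀ) := by
  rw [ctauS_gauge M L k m hW, ctauS_one]

end KingPair

end Summit.QuantumFields.YangMills.BalabanUVNodes.N15.CovAvg

end
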